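import Mathlib
import HarnessLib

set_option linter.dupNamespace false

/-!
# HodgeLocusCensusLongCycleCombinatorics — the combinatorial core of the LONG-CYCLE THEOREM (record og81/LONG-CYCLE-THEOREM-g27.md), kernel-checked

certified instances and evidence bearing on the general Hodge conjecture; no claim.

SETTING (lead record `run/shared/lean/pub/pub-hlocus/data/ivhs/census/og81/LONG-CYCLE-THEOREM-g27.md`, referee re-derivation REFEREE.md R124).  For the
single 2k-cycle matching pair on the vertices Fin (2k): M-edge i = {2i, 2i+1}, M′-edge i = {2i+1, 2i+2 (mod 2k)}, i ∈ Fin k.  The pencil equations of the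
Boolean model kill the unknown S(τ) (τ a t-subset of the M-edges) at stage 1 iff some set B 'over τ' misses an M′-edge, which happens iff two cyclically
consecutive indices i, i+1 lie outside τ (criterion (B3) of the record); a τ that survives stage 1 is killed at stage 2 if some B over τ meets every M′-edge
and its set of full M′-edges τ′ is itself stage-1 killed on the mirror side ((B2) + (B1′)).  This file kernel-checks exactly the FINITE and ARITHMETIC parts
of that argument, in the record's numbering:
* Prop. C (i)(ii)(iii): the pigeonhole `consecutiveOutside_of_two_mul_card_lt` — if 2·|τ| < k then two consecutive indices lie outside τ (so every τ is
  stage-1 killed for (t,k) = (1, ≥3), (2, ≥5), (3, ≥7));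
* Prop. C (ii′)(iv)(v): the residual lists — the t-subsets NOT stage-1 killed are exactly {0,2},{1,3} (t=2,k=4), the five rotations of {0,2,4} (t=3,k=5),
  {0,2,4},{1,3,5} (t=3,k=6) — and for each residual τ an explicit B over τ that meets every M′-edge whose full M′-edge set τ′ has two consecutive indices
  outside it (the stage-2 witnesses; these are the referee's own witnesses from g113/ref_g113_longcycle.py, not the lead's);
* Theorem E (a): the binomial identity 2C(k_B,3) + 2j·C(k_B,2) + C(j,2)(2k_B − 1) + C(j,3) = 2C(k_B+j,3) − C(j+1,3) behind c = 2C(k,3) − C(j+1,3).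
RELATION TO THE LEAD'S `HodgeLocusCensusLongCycleCore.lean` (pub-hlocus-ivhs-1 gen 27, p331918, namespace `…LongCycleCore`, written independently and
concurrently): the pigeonhole and the residual lists are formalised THERE as well (ZMod k, a covering argument, `powersetCard` filters) and HERE (Fin k, an
injection argument, a `residual` filter) — two kernel-checked implementations of the same finite facts, which is the cell's two-implementation rule applied
to Lean; the STAGE-2 WITNESSES (which close the case analysis for (2,4), (3,5), (3,6)) and the Theorem E (a) identity are only here; the join-law engine
(rank multiplicativity of ⊗) is only there.  NOT in either file (paper proof of record, referee-re-derived by hand and by exact rank computation,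
REFEREE.md R124): Lemma A (coefficient formula), Lemma B (pencil equations), Lemma D (row spaces / the walk), the join law's application, the dictionary (M)
and (†₀).  Nothing here is a statement about the Hodge conjecture.
-/

namespace Summit.HodgeConjecture.HodgeConjecture.HodgeLocus.Census.LongCycle

/-- Criterion (B3): two cyclically consecutive indices i, i+1 of `Fin k` lie outside τ (⟺ some B over τ misses an M′-edge ⟺ τ is stage-1 killed). -/
def consecutiveOutside {k : ℕ} [NeZero k] (τ : Finset (Fin k)) : Prop :=
  ∃ i : Fin k, i ∉ τ ∧ i + 1 ∉ τ

/-- `consecutiveOutside` is decidable (finite search over `Fin k`). -/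
instance {k : ℕ} [NeZero k] (τ : Finset (Fin k)) : Decidable (consecutiveOutside τ) := by
  unfold consecutiveOutside; infer_instance

/-- Prop. C (i)(ii)(iii), the pigeonhole: if no two consecutive indices lie outside τ then `i ↦ i + 1` injects τᶜ into τ, so k − |τ| ≤ |τ|. -/
theorem consecutiveOutside_of_two_mul_card_lt {k : ℕ} [NeZero k] (τ : Finset (Fin k))
    (h : 2 * τ.card < k) : consecutiveOutside τ := by
  by_contra hno
  have hmaps : ∀ i ∈ τᶜ, i + 1 ∈ τ := by
    intro i hi
    by_contra h2
    exact hno ⟨i, Finset.mem_compl.mp hi, h2⟩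
  have hinj : Set.InjOn (fun i : Fin k => i + 1) ↑(τᶜ) := by
    intro a _ b _ hab
    simpa using hab
  have hle : τᶜ.card ≤ τ.card := Finset.card_le_card_of_injOn (fun i => i + 1) hmaps hinj
  rw [Finset.card_compl, Fintype.card_fin] at hle
  omega

/-- (i): t = 1, k ≥ 3. -/
theorem killed_t1 {k : ℕ} [NeZero k] (hk : 3 ≤ k) (τ : Finset (Fin k)) (hτ : τ.card = 1) :
    consecutiveOutside τ :=
  consecutiveOutside_of_two_mul_card_lt τ (by omega)

/-- (ii): t = 2, k ≥ 5. -/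
theorem killed_t2 {k : ℕ} [NeZero k] (hk : 5 ≤ k) (τ : Finset (Fin k)) (hτ : τ.card = 2) :
    consecutiveOutside τ :=
  consecutiveOutside_of_two_mul_card_lt τ (by omega)

/-- (iii): t = 3, k ≥ 7. -/
theorem killed_t3 {k : ℕ} [NeZero k] (hk : 7 ≤ k) (τ : Finset (Fin k)) (hτ : τ.card = 3) :
    consecutiveOutside τ :=
  consecutiveOutside_of_two_mul_card_lt τ (by omega)

/-- The t-subsets of `Fin k` that are NOT stage-1 killed. -/
def residual (k t : ℕ) [NeZero k] : Finset (Finset (Fin k)) :=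
  Finset.univ.filter (fun τ => τ.card = t ∧ ¬ consecutiveOutside τ)

/-- (ii′): t = 2, k = 4 — residual {0,2}, {1,3}. -/
theorem residual_4_2 : residual 4 2 = {{0, 2}, {1, 3}} := by decide

/-- (v): t = 3, k = 5 — the five rotations of {0,2,4} (sorted). -/
theorem residual_5_3 : residual 5 3 = {{0, 1, 3}, {0, 2, 3}, {0, 2, 4}, {1, 2, 4}, {1, 3, 4}} := by decide

/-- (iv): t = 3, k = 6 — residual {0,2,4}, {1,3,5}. -/
theorem residual_6_3 : residual 6 3 = {{0, 2, 4}, {1, 3, 5}} := by decide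

/-! ## Stage-2 witnesses.  Vertices `Fin (2k)`; M-edge i = {2i, 2i+1}; M′-edge i = {2i+1, 2i+2 mod 2k}. -/

/-- The two vertices of the M-edge i. -/
def mEdge {k : ℕ} [NeZero k] (i : Fin k) : Finset (Fin (2 * k)) :=
  {⟨2 * i.val, by omega⟩, ⟨2 * i.val + 1, by omega⟩}

/-- The two vertices of the M′-edge i. -/
def mpEdge {k : ℕ} [NeZero k] (i : Fin k) : Finset (Fin (2 * k)) :=
  {⟨(2 * i.val + 1) % (2 * k), Nat.mod_lt _ (by have := NeZero.pos k; omega)⟩,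
   ⟨(2 * i.val + 2) % (2 * k), Nat.mod_lt _ (by have := NeZero.pos k; omega)⟩}

/-- B lies over τ: it contains both vertices of every M-edge in τ and exactly one vertex of every other M-edge. -/
def liesOver {k : ℕ} [NeZero k] (τ : Finset (Fin k)) (B : Finset (Fin (2 * k))) : Prop :=
  ∀ i : Fin k, (i ∈ τ → mEdge i ⊆ B) ∧ (i ∉ τ → (mEdge i ∩ B).card = 1)

/-- B meets every M′-edge (M′-admissible). -/
def meetsAllMp {k : ℕ} [NeZero k] (B : Finset (Fin (2 * k))) : Prop :=
  ∀ i : Fin k, (mpEdge i ∩ B).Nonempty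

/-- The full M′-edges of B. -/
def fullMp {k : ℕ} [NeZero k] (B : Finset (Fin (2 * k))) : Finset (Fin k) :=
  Finset.univ.filter (fun i => mpEdge i ⊆ B)

/-- `liesOver` is decidable. -/
instance {k : ℕ} [NeZero k] (τ : Finset (Fin k)) (B : Finset (Fin (2 * k))) : Decidable (liesOver τ B) := by
  unfold liesOver; infer_instance
/-- `meetsAllMp` is decidable. -/
instance {k : ℕ} [NeZero k] (B : Finset (Fin (2 * k))) : Decidable (meetsAllMp B) := by
  unfold meetsAllMp; infer_instance

/-- A stage-2 witness for τ: B over τ, M′-admissible, whose full M′-edge set is itself stage-1 killed on the mirror side. -/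
def stage2Witness {k : ℕ} [NeZero k] (τ : Finset (Fin k)) (B : Finset (Fin (2 * k))) : Prop :=
  liesOver τ B ∧ meetsAllMp B ∧ consecutiveOutside (fullMp B)

/-- `stage2Witness` is decidable. -/
instance {k : ℕ} [NeZero k] (τ : Finset (Fin k)) (B : Finset (Fin (2 * k))) : Decidable (stage2Witness τ B) := by
  unfold stage2Witness; infer_instance

/-- (ii′) witnesses, k = 4 (N = 8): τ = {0,2} ← B = {0,1,3,4,5,6} (τ′ = {1,2}); τ = {1,3} ← B = {1,2,3,4,6,7} (τ′ = {0,1}). -/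
theorem stage2_4_2 :
    stage2Witness ({0, 2} : Finset (Fin 4)) ({0, 1, 3, 4, 5, 6} : Finset (Fin 8)) ∧
    stage2Witness ({1, 3} : Finset (Fin 4)) ({1, 2, 3, 4, 6, 7} : Finset (Fin 8)) := by decide

/-- (v) witnesses, k = 5 (N = 10), one per residual triple. -/
theorem stage2_5_3 :
    stage2Witness ({0, 1, 3} : Finset (Fin 5)) ({0, 1, 2, 3, 4, 6, 7, 9} : Finset (Fin 10)) ∧
    stage2Witness ({0, 2, 3} : Finset (Fin 5)) ({0, 1, 3, 4, 5, 6, 7, 8} : Finset (Fin 10)) ∧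
    stage2Witness ({0, 2, 4} : Finset (Fin 5)) ({0, 1, 2, 4, 5, 7, 8, 9} : Finset (Fin 10)) ∧
    stage2Witness ({1, 2, 4} : Finset (Fin 5)) ({1, 2, 3, 4, 5, 6, 8, 9} : Finset (Fin 10)) ∧
    stage2Witness ({1, 3, 4} : Finset (Fin 5)) ({0, 2, 3, 5, 6, 7, 8, 9} : Finset (Fin 10)) := by decide

/-- (iv) witnesses, k = 6 (N = 12). -/
theorem stage2_6_3 :
    stage2Witness ({0, 2, 4} : Finset (Fin 6)) ({0, 1, 3, 4, 5, 6, 8, 9, 10} : Finset (Fin 12)) ∧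
    stage2Witness ({1, 3, 5} : Finset (Fin 6)) ({1, 2, 3, 4, 6, 7, 8, 10, 11} : Finset (Fin 12)) := by decide

/-- Every residual τ of (t,k) ∈ {(2,4),(3,5),(3,6)} has a stage-2 witness (the lists above cover `residual` exactly). -/
theorem residual_all_stage2 :
    (∀ τ ∈ residual 4 2, ∃ B : Finset (Fin 8), stage2Witness τ B) ∧
    (∀ τ ∈ residual 5 3, ∃ B : Finset (Fin 10), stage2Witness τ B) ∧
    (∀ τ ∈ residual 6 3, ∃ B : Finset (Fin 12), stage2Witness τ B) := by
  refine ⟨?_, ?_, ?_⟩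
  · rw [residual_4_2]
    intro τ hτ
    simp only [Finset.mem_insert, Finset.mem_singleton] at hτ
    rcases hτ with rfl | rfl
    · exact ⟨_, stage2_4_2.1⟩
    · exact ⟨_, stage2_4_2.2⟩
  · rw [residual_5_3]
    intro τ hτ
    simp only [Finset.mem_insert, Finset.mem_singleton] at hτ
    have h := stage2_5_3
    rcases hτ with rfl | rfl | rfl | rfl | rfl
    · exact ⟨_, h.1⟩
    · exact ⟨_, h.2.1⟩
    · exact ⟨_, h.2.2.1⟩
    · exact ⟨_, h.2.2.2.1⟩
    · exact ⟨_, h.2.2.2.2⟩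
  · rw [residual_6_3]
    intro τ hτ
    simp only [Finset.mem_insert, Finset.mem_singleton] at hτ
    rcases hτ with rfl | rfl
    · exact ⟨_, stage2_6_3.1⟩
    · exact ⟨_, stage2_6_3.2⟩

/-! ## Theorem E (a): the binomial arithmetic of c = 2C(k,3) − C(j+1,3). -/

/-- Vandermonde for the third binomial: C(a+b,3) = C(a,3) + C(a,2)·b + a·C(b,2) + C(b,3). -/
theorem choose_add_three (a b : ℕ) :
    (a + b).choose 3 = a.choose 3 + a.choose 2 * b + a * b.choose 2 + b.choose 3 := by
  rw [Nat.add_choose_eq]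
  simp [Finset.Nat.antidiagonal_succ, Finset.sum_insert, Nat.choose_one_right]
  ring

/-- Theorem E (a) in ℤ: the join-law sum 2C(k_B,3) + 2j·C(k_B,2) + C(j,2)(2k_B − 1) + C(j,3) equals 2C(k_B+j,3) − C(j+1,3). -/
theorem joinLaw_c (kB j : ℕ) :
    (2 * (kB.choose 3 : ℤ) + 2 * j * kB.choose 2 + j.choose 2 * (2 * kB - 1) + j.choose 3)
      = 2 * ((kB + j).choose 3 : ℤ) - (j + 1).choose 3 := by
  have h1 := choose_add_three kB j
  have h2 : (j + 1).choose 3 = j.choose 3 + j.choose 2 := by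
    rw [Nat.choose_succ_succ]; ring
  have h1' : ((kB + j).choose 3 : ℤ) = kB.choose 3 + kB.choose 2 * j + kB * j.choose 2 + j.choose 3 := by
    exact_mod_cast h1
  have h2' : ((j + 1).choose 3 : ℤ) = j.choose 3 + j.choose 2 := by exact_mod_cast h2
  rw [h1', h2']
  ring

/-- The instances quoted in the record: the ten single-long-cycle types with k_B ≥ 5, k ≤ 8. -/
theorem joinLaw_c_instances :
    (2 * (5 : ℕ).choose 3 - (1 : ℕ).choose 3 = 20) ∧ (2 * (6 : ℕ).choose 3 - (1 : ℕ).choose 3 = 40) ∧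
    (2 * (6 : ℕ).choose 3 - (2 : ℕ).choose 3 = 40) ∧ (2 * (7 : ℕ).choose 3 - (3 : ℕ).choose 3 = 69) ∧
    (2 * (7 : ℕ).choose 3 - (2 : ℕ).choose 3 = 70) ∧ (2 * (7 : ℕ).choose 3 - (1 : ℕ).choose 3 = 70) ∧
    (2 * (8 : ℕ).choose 3 - (4 : ℕ).choose 3 = 108) ∧ (2 * (8 : ℕ).choose 3 - (3 : ℕ).choose 3 = 111) ∧
    (2 * (8 : ℕ).choose 3 - (2 : ℕ).choose 3 = 112) ∧ (2 * (8 : ℕ).choose 3 - (1 : ℕ).choose 3 = 112) := by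
  decide

end Summit.HodgeConjecture.HodgeConjecture.HodgeLocus.Census.LongCycle
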